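import Summits.AtomisticToContinuum.Crystallization.Theorems.ExcessDecayLiouvilleRelaxationContraction
import Summits.AtomisticToContinuum.Crystallization.Theorems.ExcessDecayLiouvilleTaylorJumpRows

/-!
# Route `ExcessDecayLiouville`: the natural force is Lipschitz in slope and jump (nonlinear half, XV)

Harmonic-replacement architecture for item `ExcessDecay` (stmt-AtomisticToContinuum-9334), nonlinear half.
The relaxation of each step (`exists_relaxed_field`) shifts one sublattice by `ξ` with
`‖ξ‖ ≤ (4/κ)‖Ψ_{B'}(s')‖`, where `Ψ_B(s)` is the natural force at `t 0` of the two-lattice displaced by the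
slope `B` and the jump `s`; the previous approximant was relaxed, `Ψ_B(s) = 0`.  Here we bound the
variation (`norm_natForce_sub_le`):

`‖Ψ_{B'}(s') − Ψ_B(s)‖ ≤ C_s ‖s' − s‖ + C_B ‖B' − B‖`  (`‖B‖, ‖B'‖, ‖s‖, ‖s'‖ ≤ 1/200`),

from the jump linearisation `norm_natForce_lin_le`, the bound `‖M β‖ ≤ 38 (25/23) S₇ ‖β‖` of the cross
force-constant operator (`norm_crossFC_apply_le`) and a per-bond slope estimate (`norm_bond_slope_le`,
with a crude branch for the astronomically far bonds where the slope perturbation is not small).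
All `[folklore]`; helper lemmas, nothing here closes an item.
-/

noncomputable section

namespace Summit.AtomisticToContinuum.Crystallization.Theorems.ExcessDecayLiouville

open scoped BigOperators Topology InnerProductSpace RealInnerProductSpace Classical
open Literature.MathematicalPhysics.StatisticalMechanics
open Summit.AtomisticToContinuum.Crystallization.Theorems.PhononStabilityNegative

local notation "E3" => EuclideanSpace ℝ (Fin 3)

-- Local notation: the force-constant map `K(e)w = h(|e|²)w + 2⟪e,w⟫h′(|e|²)e` (`= forceConst e w`).
local notation3 "𝕂[" e "] " w:max =>
  (-((‖e‖ ^ 2)⁻¹) ^ 7 + ((‖e‖ ^ 2)⁻¹) ^ 4) • w + (2 * ⟪e, w⟫ * (7 * ((‖e‖ ^ 2)⁻¹) ^ 8 - 4 * ((‖e‖ ^ 2)⁻¹) ^ 5)) • e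
-- Local notation: the pair force `F(x) = h(|x|²) x`.
local notation3 "𝐅[" x "]" => ((-((‖x‖ ^ 2)⁻¹) ^ 7 + ((‖x‖ ^ 2)⁻¹) ^ 4) • x)
-- Local notation: the remainder `R(e, w) = F(e + w) − F(e) − K(e) w`.
local notation3 "ℛ[" e ", " w "]" => (𝐅[e + w] - 𝐅[e] - 𝕂[e] w)

/-! ## One bond, slope variation -/

/-- **Slope variation of one displaced bond**: for `|e| ≥ 23/25`, `‖B‖, ‖B'‖ ≤ 1/200`, `‖σ‖ ≤ 1/200`,
`‖F(e + (B'e + σ)) − F(e + (Be + σ))‖ ≤ 5660 ‖B' − B‖ |e|⁻⁶`. [folklore] -/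
theorem norm_bond_slope_le {B B' : E3 →L[ℝ] E3} {e σ : E3} (he : 23 / 25 ≤ ‖e‖) (hB : ‖B‖ ≤ 1 / 200)
    (hB' : ‖B'‖ ≤ 1 / 200) (hσ : ‖σ‖ ≤ 1 / 200) :
    ‖𝐅[e + (B' e + σ)] - 𝐅[e + (B e + σ)]‖ ≤ 5660 * ‖B' - B‖ * (‖e‖⁻¹) ^ 6 := by
  have he0 : 0 < ‖e‖ := by linarith
  have hdB : 0 ≤ ‖B' - B‖ := norm_nonneg _
  have hi0 : 0 ≤ ‖e‖⁻¹ := inv_nonneg.2 he0.le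
  have hi1 : ‖e‖⁻¹ ≤ 25 / 23 := by rw [inv_le_comm₀ he0 (by norm_num)]; linarith
  have hBe : ‖B e‖ ≤ ‖e‖ / 200 := (B.le_opNorm e).trans (by nlinarith [norm_nonneg e])
  have hB'e : ‖B' e‖ ≤ ‖e‖ / 200 := (B'.le_opNorm e).trans (by nlinarith [norm_nonneg e])
  have hσe : ‖σ‖ ≤ ‖e‖ / 184 := by nlinarith
  -- the two displaced bonds are long
  have hea : (59 / 60) * ‖e‖ ≤ ‖e + (B e + σ)‖ := by
    have h1 : ‖B e + σ‖ ≤ ‖e‖ / 60 := (norm_add_le _ _).trans (by linarith)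
    have := norm_sub_norm_le e (-(B e + σ)); rw [sub_neg_eq_add, norm_neg] at this; linarith
  have hea' : (59 / 60) * ‖e‖ ≤ ‖e + (B' e + σ)‖ := by
    have h1 : ‖B' e + σ‖ ≤ ‖e‖ / 60 := (norm_add_le _ _).trans (by linarith)
    have := norm_sub_norm_le e (-(B' e + σ)); rw [sub_neg_eq_add, norm_neg] at this; linarith
  have hea9 : 9 / 10 ≤ ‖e + (B e + σ)‖ := by linarith
  have hinv : ‖e + (B e + σ)‖⁻¹ ≤ 60 / 59 * ‖e‖⁻¹ := by
    rw [inv_le_comm₀ (by linarith) (by positivity), mul_inv, inv_inv]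
    have : (60 / 59 : ℝ)⁻¹ * ‖e‖ = 59 / 60 * ‖e‖ := by norm_num
    rw [this]; exact hea
  have hinv' : ‖e + (B' e + σ)‖⁻¹ ≤ 60 / 59 * ‖e‖⁻¹ := by
    rw [inv_le_comm₀ (by linarith) (by positivity), mul_inv, inv_inv]
    have : (60 / 59 : ℝ)⁻¹ * ‖e‖ = 59 / 60 * ‖e‖ := by norm_num
    rw [this]; exact hea'
  have hia0 : 0 ≤ ‖e + (B e + σ)‖⁻¹ := inv_nonneg.2 (by linarith)
  have hia0' : 0 ≤ ‖e + (B' e + σ)‖⁻¹ := inv_nonneg.2 (by linarith)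
  -- the slope perturbation
  have hsplit : e + (B' e + σ) = (e + (B e + σ)) + (B' - B) e := by
    rw [show (B' - B) e = B' e - B e from rfl]; abel
  have hd : ‖(B' - B) e‖ ≤ ‖B' - B‖ * ‖e‖ := (B' - B).le_opNorm e
  by_cases hsmall : ‖(B' - B) e‖ ≤ 1 / 10
  · -- expansion: F(e' + d) − F(e') = K(e') d + R(e', d)
    have hrem := norm_remainder_le hea9 hsmall
    have hK := norm_forceConst_apply_le hea9 ((B' - B) e)
    have hid : 𝐅[e + (B' e + σ)] - 𝐅[e + (B e + σ)] =
        𝕂[e + (B e + σ)] ((B' - B) e) + ℛ[e + (B e + σ), (B' - B) e] := by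
      rw [hsplit]; abel
    rw [hid]
    have h8 : ‖e + (B e + σ)‖⁻¹ ^ 8 ≤ (60 / 59 * ‖e‖⁻¹) ^ 8 := pow_le_pow_left₀ hia0 hinv 8
    have h9 : ‖e + (B e + σ)‖⁻¹ ^ 9 ≤ (60 / 59 * ‖e‖⁻¹) ^ 9 := pow_le_pow_left₀ hia0 hinv 9
    calc ‖𝕂[e + (B e + σ)] ((B' - B) e) + ℛ[e + (B e + σ), (B' - B) e]‖
        ≤ 38 * ‖e + (B e + σ)‖⁻¹ ^ 8 * ‖(B' - B) e‖ + 6000 * ‖e + (B e + σ)‖⁻¹ ^ 9 * ‖(B' - B) e‖ ^ 2 :=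
          (norm_add_le _ _).trans (add_le_add hK hrem)
      _ ≤ 38 * (60 / 59 * ‖e‖⁻¹) ^ 8 * (‖B' - B‖ * ‖e‖) + 6000 * (60 / 59 * ‖e‖⁻¹) ^ 9 * ((‖B' - B‖ * ‖e‖) * (1 / 10)) := by
          gcongr
          · calc ‖(B' - B) e‖ ^ 2 = ‖(B' - B) e‖ * ‖(B' - B) e‖ := sq _
              _ ≤ (‖B' - B‖ * ‖e‖) * (1 / 10) := mul_le_mul hd hsmall (norm_nonneg _) (by positivity)
      _ = (38 * (60 / 59 : ℝ) ^ 8 * (‖e‖⁻¹ * ‖e‖) + 600 * (60 / 59 : ℝ) ^ 9 * ‖e‖⁻¹ * (‖e‖⁻¹ * ‖e‖)) *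
            ‖B' - B‖ * (‖e‖⁻¹ * ‖e‖⁻¹ ^ 6) := by ring
      _ = (38 * (60 / 59 : ℝ) ^ 8 + 600 * (60 / 59 : ℝ) ^ 9 * ‖e‖⁻¹) * ‖B' - B‖ * (‖e‖⁻¹ * ‖e‖⁻¹ ^ 6) := by
          rw [inv_mul_cancel₀ he0.ne', mul_one, mul_one]
      _ ≤ (38 * (60 / 59 : ℝ) ^ 8 + 600 * (60 / 59 : ℝ) ^ 9 * (25 / 23)) * ‖B' - B‖ * ((25 / 23) * ‖e‖⁻¹ ^ 6) := by
          gcongr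
      _ ≤ 5660 * ‖B' - B‖ * ‖e‖⁻¹ ^ 6 := by
          have h1 : (60 / 59 : ℝ) ^ 8 ≤ 6 / 5 := by norm_num
          have h2 : (60 / 59 : ℝ) ^ 9 ≤ 6 / 5 := by norm_num
          have h6 : 0 ≤ ‖e‖⁻¹ ^ 6 := by positivity
          nlinarith [mul_nonneg hdB h6]
  · -- crude branch: both forces are ≤ 246 |·|⁻⁷ and |e|⁻¹ ≤ 10 ‖B' − B‖
    have hbig : 1 / 10 < ‖(B' - B) e‖ := lt_of_not_ge hsmall
    have h1 : 1 ≤ 10 * (‖B' - B‖ * ‖e‖) := by linarith [hbig.trans_le hd]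
    have hie : ‖e‖⁻¹ ≤ 10 * ‖B' - B‖ := by
      calc ‖e‖⁻¹ = ‖e‖⁻¹ * 1 := (mul_one _).symm
        _ ≤ ‖e‖⁻¹ * (10 * (‖B' - B‖ * ‖e‖)) := mul_le_mul_of_nonneg_left h1 hi0
        _ = 10 * ‖B' - B‖ * (‖e‖⁻¹ * ‖e‖) := by ring
        _ = 10 * ‖B' - B‖ := by rw [inv_mul_cancel₀ he0.ne', mul_one]
    have hx : 2 / 5 ≤ ‖e + (B e + σ)‖ := by linarith
    have hx' : 2 / 5 ≤ ‖e + (B' e + σ)‖ := by linarith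
    have hF := norm_pairForce_le hx
    have hF' := norm_pairForce_le hx'
    have h7 : ‖e + (B e + σ)‖⁻¹ ^ 7 ≤ (60 / 59 * ‖e‖⁻¹) ^ 7 := pow_le_pow_left₀ hia0 hinv 7
    have h7' : ‖e + (B' e + σ)‖⁻¹ ^ 7 ≤ (60 / 59 * ‖e‖⁻¹) ^ 7 := pow_le_pow_left₀ hia0' hinv' 7
    calc ‖𝐅[e + (B' e + σ)] - 𝐅[e + (B e + σ)]‖ ≤ ‖𝐅[e + (B' e + σ)]‖ + ‖𝐅[e + (B e + σ)]‖ := norm_sub_le _ _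
      _ ≤ 246 * ‖e + (B' e + σ)‖⁻¹ ^ 7 + 246 * ‖e + (B e + σ)‖⁻¹ ^ 7 := add_le_add hF' hF
      _ ≤ 246 * (60 / 59 * ‖e‖⁻¹) ^ 7 + 246 * (60 / 59 * ‖e‖⁻¹) ^ 7 := by gcongr
      _ = 492 * (60 / 59 : ℝ) ^ 7 * ‖e‖⁻¹ * ‖e‖⁻¹ ^ 6 := by ring
      _ ≤ 492 * (60 / 59 : ℝ) ^ 7 * (10 * ‖B' - B‖) * ‖e‖⁻¹ ^ 6 := by gcongr
      _ ≤ 5660 * ‖B' - B‖ * ‖e‖⁻¹ ^ 6 := by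
          have h60 : (60 / 59 : ℝ) ^ 7 ≤ 115 / 100 := by norm_num
          have h6 : 0 ≤ ‖e‖⁻¹ ^ 6 := by positivity
          nlinarith [mul_nonneg hdB h6]

section

variable {t : Fin 2 → E3} {A : E3 →L[ℝ] E3}

set_option quotPrecheck false in
-- Local notation: the cross force-constant operator `M = Σ'_{q ∈ S₁} K(t 0 − q)`.
local notation "𝐌ₓ" =>
  tsum (fun q : Sites₀ t A => (if (∃ z ∈ Λ₀, (q : E3) = t 1 + A z) then forceConst ((t 0 : E3) - q) else 0))

set_option quotPrecheck false in
-- Local notation: the natural force `Ψ_B(s)` at `t 0` of the two-lattice displaced by slope `B` and jump `s`.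
local notation "𝚿[" B ", " s "]" =>
  tsum (fun q : Sites₀ t A => (if (t 0 : E3) ≠ q then
    𝐅[((t 0 : E3) - q) + (B ((t 0 : E3) - q) + (if (∃ z ∈ Λ₀, (q : E3) = t 1 + A z) then s else 0))] else 0))

/-! ## The cross force-constant operator is bounded -/

/-- `‖M β‖ ≤ 38 (25/23) S₇ ‖β‖`, `S₇ = 1024/((23/25)³(23/25)⁴)`. [folklore] -/
theorem norm_crossFC_apply_le (hA : Adm₀ A) (hI : Inner₀ t A) (β : E3) :
    ‖(𝐌ₓ) β‖ ≤ 38 * (25 / 23) * (1024 / ((23 / 25 : ℝ) ^ 3 * (23 / 25 : ℝ) ^ 4)) * ‖β‖ := by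
  obtain ⟨μ, hμ⟩ : ∃ μ : E3, μ = (𝐌ₓ) β := ⟨_, rfl⟩
  rw [← hμ]
  have hμ' : μ = ∑' q : Sites₀ t A, (if (∃ z ∈ Λ₀, (q : E3) = t 1 + A z) then 𝕂[(t 0 : E3) - q] β else 0) := by
    rw [hμ]; exact crossFC_apply hA hI β
  obtain ⟨h7s, h7le⟩ := summable_inv_pow_seven_sites hA hI (t0_mem_sites (t := t) (A := A))
  have hbd : ∀ q : Sites₀ t A, ‖(if (∃ z ∈ Λ₀, (q : E3) = t 1 + A z) then 𝕂[(t 0 : E3) - q] β else 0)‖ ≤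
      38 * (25 / 23) * ‖β‖ * (if (q : E3) ≠ t 0 then (dist (q : E3) (t 0))⁻¹ ^ 7 else 0) := by
    intro q
    by_cases hq : ∃ z ∈ Λ₀, (q : E3) = t 1 + A z
    · have hne : (t 0 : E3) ≠ q := by
        obtain ⟨z, hz, hqz⟩ := hq
        rw [hqz]
        have := sublattice_ne hA hI (zero_mem_Λ₀) hz (t := t) (A := A)
        simpa using this
      rw [if_pos hq, if_pos (Ne.symm hne)]
      have h := norm_forceConst_sites_le hA hI (t0_mem_sites (t := t) (A := A)) q hne
      calc ‖𝕂[(t 0 : E3) - q] β‖ = ‖forceConst ((t 0 : E3) - q) β‖ := by rw [forceConst_apply]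
        _ ≤ ‖forceConst ((t 0 : E3) - q)‖ * ‖β‖ := ContinuousLinearMap.le_opNorm _ _
        _ ≤ 38 * (25 / 23) * (dist (q : E3) (t 0))⁻¹ ^ 7 * ‖β‖ := by gcongr
        _ = _ := by ring
    · rw [if_neg hq, norm_zero]
      positivity
  rw [hμ']
  calc _ ≤ ∑' q : Sites₀ t A, 38 * (25 / 23) * ‖β‖ * (if (q : E3) ≠ t 0 then (dist (q : E3) (t 0))⁻¹ ^ 7 else 0) :=
        tsum_of_norm_bounded (h7s.mul_left _).hasSum hbd
    _ = 38 * (25 / 23) * ‖β‖ * ∑' q : Sites₀ t A, (if (q : E3) ≠ t 0 then (dist (q : E3) (t 0))⁻¹ ^ 7 else 0) := tsum_mul_left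
    _ ≤ 38 * (25 / 23) * ‖β‖ * (1024 / ((23 / 25 : ℝ) ^ 3 * (23 / 25 : ℝ) ^ 4)) := by gcongr
    _ = _ := by ring

/-! ## The variation of the natural force -/

/-- **Slope variation of the natural force**: `‖Ψ_{B'}(s) − Ψ_B(s)‖ ≤ 5660 S₆ ‖B' − B‖`,
`S₆ = 1024/((23/25)³(23/25)³)`. [folklore] -/
theorem norm_natForce_slope_le (hA : Adm₀ A) (hI : Inner₀ t A) {B B' : E3 →L[ℝ] E3} (hB : ‖B‖ ≤ 1 / 200)
    (hB' : ‖B'‖ ≤ 1 / 200) {s : E3} (hs : ‖s‖ ≤ 1 / 200) :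
    ‖𝚿[B', s] - 𝚿[B, s]‖ ≤ 5660 * (1024 / ((23 / 25 : ℝ) ^ 3 * (23 / 25 : ℝ) ^ 3)) * ‖B' - B‖ := by
  have hsum := summable_natForce hA hI (hB.trans (by norm_num)) (hs.trans (by norm_num)) (B := B)
  have hsum' := summable_natForce hA hI (hB'.trans (by norm_num)) (hs.trans (by norm_num)) (B := B')
  rw [← hsum'.tsum_sub hsum]
  obtain ⟨h6s, h6le⟩ := summable_inv_pow_six_sites hA hI (t0_mem_sites (t := t) (A := A))
  have hbd : ∀ q : Sites₀ t A, ‖(if (t 0 : E3) ≠ q then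
      𝐅[((t 0 : E3) - q) + (B' ((t 0 : E3) - q) + (if (∃ z ∈ Λ₀, (q : E3) = t 1 + A z) then s else 0))] else 0) -
      (if (t 0 : E3) ≠ q then
      𝐅[((t 0 : E3) - q) + (B ((t 0 : E3) - q) + (if (∃ z ∈ Λ₀, (q : E3) = t 1 + A z) then s else 0))] else 0)‖ ≤
      5660 * ‖B' - B‖ * (if (q : E3) ≠ t 0 then (dist (q : E3) (t 0))⁻¹ ^ 6 else 0) := by
    intro q
    by_cases hq : (t 0 : E3) ≠ q
    · rw [if_pos hq, if_pos hq, if_pos (Ne.symm hq)]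
      have hd := dist_sites_ge hA hI (t0_mem_sites (t := t) (A := A)) q.2 hq
      have he : 23 / 25 ≤ ‖(t 0 : E3) - q‖ := by rwa [← dist_eq_norm]
      have hσ : ‖(if (∃ z ∈ Λ₀, (q : E3) = t 1 + A z) then s else 0)‖ ≤ 1 / 200 := by
        split_ifs
        · exact hs
        · rw [norm_zero]; norm_num
      refine (norm_bond_slope_le he hB hB' hσ).trans (le_of_eq ?_)
      have hnd : ‖(t 0 : E3) - q‖ = dist (q : E3) (t 0) := by rw [← dist_eq_norm, dist_comm]
      rw [hnd]
    · rw [if_neg hq, if_neg hq, if_neg (fun h' => hq (Ne.symm h')), sub_zero, norm_zero, mul_zero]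
  calc _ ≤ ∑' q : Sites₀ t A, 5660 * ‖B' - B‖ * (if (q : E3) ≠ t 0 then (dist (q : E3) (t 0))⁻¹ ^ 6 else 0) :=
        tsum_of_norm_bounded (h6s.mul_left _).hasSum hbd
    _ = 5660 * ‖B' - B‖ * ∑' q : Sites₀ t A, (if (q : E3) ≠ t 0 then (dist (q : E3) (t 0))⁻¹ ^ 6 else 0) := tsum_mul_left
    _ ≤ 5660 * ‖B' - B‖ * (1024 / ((23 / 25 : ℝ) ^ 3 * (23 / 25 : ℝ) ^ 3)) := by gcongr
    _ = _ := by ring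

/-- **The natural force is Lipschitz in slope and jump** (see the module docstring): for
`‖B‖, ‖B'‖, ‖s‖, ‖s'‖ ≤ 1/200`,
`‖Ψ_{B'}(s') − Ψ_B(s)‖ ≤ (38(25/23)S₇ + S₇(25/23)²(72 + 2000)) ‖s' − s‖ + 5660 S₆ ‖B' − B‖`. [folklore] -/
theorem norm_natForce_sub_le (hA : Adm₀ A) (hI : Inner₀ t A) {B B' : E3 →L[ℝ] E3} (hB : ‖B‖ ≤ 1 / 200)
    (hB' : ‖B'‖ ≤ 1 / 200) {s s' : E3} (hs : ‖s‖ ≤ 1 / 200) (hs' : ‖s'‖ ≤ 1 / 200) :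
    ‖𝚿[B', s'] - 𝚿[B, s]‖ ≤
      (38 * (25 / 23) * (1024 / ((23 / 25 : ℝ) ^ 3 * (23 / 25 : ℝ) ^ 4)) +
        (1024 / ((23 / 25 : ℝ) ^ 3 * (23 / 25 : ℝ) ^ 4)) * ((25 / 23 : ℝ) ^ 2 * (72 + 2000))) * ‖s' - s‖ +
      5660 * (1024 / ((23 / 25 : ℝ) ^ 3 * (23 / 25 : ℝ) ^ 3)) * ‖B' - B‖ := by
  -- jump variation at slope B'
  have hlin := norm_natForce_lin_le hA hI hB' hs hs' (t := t) (A := A)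
  have hM := norm_crossFC_apply_le hA hI (s' - s) (t := t) (A := A)
  have hslope := norm_natForce_slope_le hA hI hB hB' hs
  have hds : 0 ≤ ‖s' - s‖ := norm_nonneg _
  have hds1 : ‖s' - s‖ ≤ 1 / 100 := (norm_sub_le _ _).trans (by linarith)
  have hBs : ‖B'‖ + ‖s‖ ≤ 1 / 100 := by linarith
  -- ‖Ψ_{B'}(s') − Ψ_{B'}(s)‖ ≤ ‖M(s'−s)‖ + linearisation error
  have h1 : ‖𝚿[B', s'] - 𝚿[B', s]‖ ≤
      (38 * (25 / 23) * (1024 / ((23 / 25 : ℝ) ^ 3 * (23 / 25 : ℝ) ^ 4)) +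
        (1024 / ((23 / 25 : ℝ) ^ 3 * (23 / 25 : ℝ) ^ 4)) * ((25 / 23 : ℝ) ^ 2 * (72 + 2000))) * ‖s' - s‖ := by
    have htri : ‖𝚿[B', s'] - 𝚿[B', s]‖ ≤ ‖𝚿[B', s'] - 𝚿[B', s] - (𝐌ₓ) (s' - s)‖ + ‖(𝐌ₓ) (s' - s)‖ := by
      have := norm_add_le (𝚿[B', s'] - 𝚿[B', s] - (𝐌ₓ) (s' - s)) ((𝐌ₓ) (s' - s))
      rwa [sub_add_cancel] at this
    refine htri.trans ?_
    have hlin' : ‖𝚿[B', s'] - 𝚿[B', s] - (𝐌ₓ) (s' - s)‖ ≤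
        (1024 / ((23 / 25 : ℝ) ^ 3 * (23 / 25 : ℝ) ^ 4)) * ((25 / 23 : ℝ) ^ 2 * (72 + 2000)) * ‖s' - s‖ := by
      refine hlin.trans ?_
      have hin : 7200 * ‖s' - s‖ + 200000 * (‖B'‖ + ‖s‖) ≤ 72 + 2000 := by linarith
      have h0 : 0 ≤ (1024 / ((23 / 25 : ℝ) ^ 3 * (23 / 25 : ℝ) ^ 4)) := by positivity
      calc (1024 / ((23 / 25 : ℝ) ^ 3 * (23 / 25 : ℝ) ^ 4)) *
            ((25 / 23 : ℝ) ^ 2 * (7200 * ‖s' - s‖ + 200000 * (‖B'‖ + ‖s‖)) * ‖s' - s‖)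
          ≤ (1024 / ((23 / 25 : ℝ) ^ 3 * (23 / 25 : ℝ) ^ 4)) * ((25 / 23 : ℝ) ^ 2 * (72 + 2000) * ‖s' - s‖) := by
            gcongr
        _ = _ := by ring
    linarith
  -- combine with the slope variation
  have htri2 : ‖𝚿[B', s'] - 𝚿[B, s]‖ ≤ ‖𝚿[B', s'] - 𝚿[B', s]‖ + ‖𝚿[B', s] - 𝚿[B, s]‖ := by
    have := norm_add_le (𝚿[B', s'] - 𝚿[B', s]) (𝚿[B', s] - 𝚿[B, s])
    rwa [sub_add_sub_cancel] at this
  linarith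

end


end Summit.AtomisticToContinuum.Crystallization.Theorems.ExcessDecayLiouville

end
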